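/-
Copyright (c) 2026 the pub-hodgecm-mathlib formalisation cell (harness21).  Prover seat hodgecm-mathlib-K2Liu-p08 (g2), Track B «K2-LIT»,
#184♮ = hLiu418 = `stmt-HodgeConjecture-24832`; LEAD F0P6-plan (g13) RULINGS «M-157b» (β5) 2026-09-04T08:37:16Z and «M-157j» (2) 08:58:24Z (+ BYTE NOTE
09:00:18Z); census `K2/K2Liu-p08/g2/CENSUS-beta5-GL2GodementSectionOfFlatArch.K2Liu-p08-g2.md`.  Road Φ of socket #41, organ G5 (β) «Godement sections exhaust the
flat sections», file (β5): THE COMPLEX PLACES.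
-/
import Literature.NumberTheory.Automorphic.TateLocalZetaArchimedean     -- ★ `TateArchimedean.zeta_complex` (Tate 1950 §2.5, `k` complex)
import Summits.HodgeConjecture.HodgeConjecture.Theorems.K2LiuCompactUnitaryFiniteFunctionsPolynomial   -- ★ (K∞-str) face producer; `eval_bind₁`
import Mathlib.LinearAlgebra.UnitaryGroup
import Mathlib.Analysis.Complex.Circle
import Mathlib.Analysis.SpecialFunctions.Gamma.Beta
import Mathlib.Algebra.MvPolynomial.Monad
import Mathlib.LinearAlgebra.LinearIndependent.Lemmas
import HarnessLib

/-!
# Crux `HLiu418`, Road Φ, organ G5 (β) file (β5): GODEMENT SECTIONS OF FLAT `U(2)`-FINITE SECTIONS OF `GL₂(ℂ)` — the complex places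

Cell `hodgecm-mathlib`, crux item hLiu418 = `stmt-HodgeConjecture-24832` (helper lane `--supports`, count-neutral).  THEOREMS ONLY (no `def`, no instance,
no notation, no named-fact hypothesis, no `sorry`).  The archimedean twin of ★ (β1) `K2LiuGL2GodementSectionOfFlatFinite` ∕ `K2LiuGL2GodementCoefficientFinite`
(K2Liu-p14 (g0)): at a complex place a FLAT section of the unramified principal series `Ind_B^{GL₂(ℂ)}(|·|^s, |·|^{−s})` is determined by its restriction `F₀` to
`K = U(2) = Matrix.unitaryGroup (Fin 2) ℂ`, a function with `F₀ (p k) = F₀ k` for `p ∈ B ∩ K` (diagonal unitary; hypothesis `hB`), and `K`-finiteness makes `F₀` a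
POLYNOMIAL in the entries and their conjugates — the (K∞-str) face of ★ `K2LiuCompactUnitaryFiniteFunctionsPolynomial.exists_mvPolynomial_of_finiteDimensional_span_rightTranslates`
(K2Liu-p05 (g4)), taken here BY VALUE as `hF` in exactly those letters (`MvPolynomial ((Fin 2 × Fin 2) ⊕ (Fin 2 × Fin 2)) ℂ`, `eval (Sum.elim entries (conj ∘ entries))`).
TATE'S LEBESGUE COORDINATES (★ `TateArchimedean.zeta_complex`: `|α|_ℂ = r²`, `d^×α = 2dxdy∕r²`, `e^{−2πzz̄}`): the arch Godement integral is `∫_ℂ Φ(z • x)(|z|²)^{w−1}·2 dz`.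
* §1 monomials in `(y, ȳ)` on `ℂ²`: `eval_monomial_two`, `eval_monomial_smul` (a monomial of bidegree `(a, b)` scales by `z^a z̄^b` under `y ↦ z • y`).
* §2 CIRCLE INVARIANCE KILLS THE OFF-DIAGONAL BIDEGREES: `circle_chars_linearIndependent` (Dedekind, Mathlib `linearIndependent_monoidHom`; no angular integral) ⇒
  **`eval_eq_sum_diagonal_of_circle_invariant`**: a polynomial `Q(y, ȳ)` with `Q(u • x) = Q(x)` for all `u ∈ U(1)` equals at `x` the sum of its DIAGONAL monomials.
* §3 THE Γ-FACTOR: **`integral_pow_mul_conj_pow_gaussian_cpow`** `∫_ℂ z^a z̄^a e^{−2π|z|²}(|z|²)^{w−1}·2 dz = (2π)^{1−w−a} Γ(w+a)` (`re(w+a) > 0`; ★ `zeta_complex 0` at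
  `s := w + a`), `gammaFactor_ne_zero`, `gammaFactor_inv_eq`, `differentiable_gammaFactor_inv` (`[(2π)^{1−w−a}Γ(w+a)]⁻¹ = (2π)^{w+a−1}Γ(w+a)⁻¹` is ENTIRE),
  **`integral_godement_monomial`** (a diagonal monomial × Gaussian at a unit row: `= (2π)^{1−w−a}Γ(w+a) · c x^m`).
* §4 `U(2)` PLUMBING (the `SU(2)` lift `κ(x) = !![conj x₁, −conj x₀; x₀, x₁]` written out): `kappa_mem_unitaryGroup`, `row_one_mul_conj_eq_one`, `apply_eq_apply_kappa`
  (`(kκ⁻¹)₁₀ = 0`, `hB`), `apply_kappa_smul` (`κ(u x) = diag(ū,u) κ(x)`), `eval_kappa` (`F₀ ∘ κ = Q(x, x̄)`, `Q := bind₁ θ P` explicit).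
* §5 **`exists_godement_arch_of_flat_polynomial`**: `F₀ k = Σ_{m ∈ ι} [(2π)^{1−w−a(m)} Γ(w+a(m))]⁻¹ · ∫_ℂ Φ_m(z • e₂k)(|z|²)^{w−1}·2 dz` for every `k ∈ U(2)` and every
  `w` with `0 < re w`, with FINITELY many explicit `K`-finite data `Φ_m(y) = c_m y^m e^{−2π|y|²}` (diagonal monomials × Gaussian) and ENTIRE coefficients — the (β0) face of
  M-157b at a complex place (`w = 2s`); the Γ-factor depends on the bidegree: the `harch` letter of (β4-iii) is INDEXED (K2Liu-p14 (g0) 09:12:29Z «=»).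
NOT HERE: Iwasawa extension to `GL₂(ℂ)`, `SchwartzMap` packaging (p05 (SD-1) currency), the Haar constant `ν_∞ ↔ Lebesgue` ((β4-iii) (r1), K2Liu-p14 (g0)).
[Tate1950, §2.5] [JacquetLanglands1970, §5–§6] [Bump1997, §2.8, §3.7] [CogdellAnalyticTheory2004, §2.3].  HONEST LABEL.  Count-neutral helper; `HC_CM` is proved
only modulo the 7 printed citations (2 remaining named inputs: hLiu418 = `stmt-HodgeConjecture-24832`, h413 = `stmt-HodgeConjecture-24833`) until rung 0 closes.
-/

set_option autoImplicit false
set_option linter.dupNamespace false -- the mandated namespace repeats `HodgeConjecture.HodgeConjecture`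

noncomputable section

namespace Summit.HodgeConjecture.HodgeConjecture.Cruxes.HLiu418.K2LiuGL2GodementSectionOfFlatArch

open MeasureTheory Set Real Complex MvPolynomial
open scoped ComplexConjugate BigOperators Matrix

/-! ## §1 Monomials in `(y, ȳ)` on `ℂ²` -/

section Monomials

/-- the value of a monomial `c · y^{m_inl} ȳ^{m_inr}` at a row `y ∈ ℂ²`. [folklore] -/
theorem eval_monomial_two (m : (Fin 2 ⊕ Fin 2) →₀ ℕ) (c : ℂ) (y : Fin 2 → ℂ) :
    eval (Sum.elim y (fun i => conj (y i))) (monomial m c) =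
      c * ((y 0 ^ m (Sum.inl 0) * y 1 ^ m (Sum.inl 1)) * (conj (y 0) ^ m (Sum.inr 0) * conj (y 1) ^ m (Sum.inr 1))) := by
  rw [eval_monomial, Finsupp.prod_fintype _ _ (fun n => pow_zero _), Fintype.prod_sum_type, Fin.prod_univ_two, Fin.prod_univ_two]
  rfl

/-- **a monomial of bidegree `(a, b)` scales by `z^a z̄^b`** under `y ↦ z • y`. [folklore] -/
theorem eval_monomial_smul (m : (Fin 2 ⊕ Fin 2) →₀ ℕ) (c z : ℂ) (x : Fin 2 → ℂ) :
    eval (Sum.elim (z • x) (fun i => conj ((z • x) i))) (monomial m c) =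
      z ^ (m (Sum.inl 0) + m (Sum.inl 1)) * conj z ^ (m (Sum.inr 0) + m (Sum.inr 1)) *
        eval (Sum.elim x (fun i => conj (x i))) (monomial m c) := by
  rw [eval_monomial_two, eval_monomial_two]
  simp only [Pi.smul_apply, smul_eq_mul, map_mul, mul_pow, pow_add]
  ring

end Monomials

/-! ## §2 Circle invariance kills the off-diagonal bidegrees -/

section CircleInvariance

/-- **Dedekind**: the characters `u ↦ u^d` (`d ∈ ℤ`) of the circle group are linearly independent over `ℂ`. [folklore] -/
theorem circle_chars_linearIndependent : LinearIndependent ℂ (fun d : ℤ => fun u : Circle => ((u : ℂ) ^ d)) := by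
  set χ : ℤ → (Circle →* ℂ) := fun d => Circle.coeHom.comp (zpowGroupHom d) with hχ
  have hχapp : ∀ d (u : Circle), χ d u = (u : ℂ) ^ d := fun d u => by
    simp only [hχ, MonoidHom.coe_comp, Function.comp_apply, zpowGroupHom_apply, map_zpow]
    rfl
  have hinj : Function.Injective χ := by
    intro d d' h
    by_contra hne
    have hsub : ((d - d' : ℤ) : ℝ) ≠ 0 := by exact_mod_cast sub_ne_zero.2 hne
    set u : Circle := Circle.exp (Real.pi / ((d - d' : ℤ) : ℝ)) with hu
    have h1 : (u : ℂ) ^ d = (u : ℂ) ^ d' := by rw [← hχapp, ← hχapp, h]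
    have hu0 : (u : ℂ) ≠ 0 := Circle.coe_ne_zero u
    have h2 : (u : ℂ) ^ (d - d') = 1 := by rw [zpow_sub₀ hu0, h1, div_self (zpow_ne_zero _ hu0)]
    have h3 : u ^ (d - d') = Circle.exp Real.pi := by
      rw [hu, ← Circle.exp_zsmul, zsmul_eq_mul]
      congr 1
      field_simp
    have h4 : u ^ (d - d') = 1 := by
      refine Circle.coe_injective ?_
      have h5 : ((u ^ (d - d') : Circle) : ℂ) = (u : ℂ) ^ (d - d') := map_zpow Circle.coeHom u (d - d')
      rw [h5, h2]
      rfl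
    exact Circle.exp_pi_ne_one (h3 ▸ h4)
  have hli := (linearIndependent_monoidHom Circle ℂ).comp χ hinj
  have heq : (fun d : ℤ => fun u : Circle => ((u : ℂ) ^ d)) = (fun f : Circle →* ℂ => (f : Circle → ℂ)) ∘ χ := by
    funext d u; exact (hχapp d u).symm
  rw [heq]; exact hli

/-- **CIRCLE INVARIANCE KILLS THE OFF-DIAGONAL BIDEGREES**: if a polynomial `Q(y, ȳ)` on `ℂ²` satisfies `Q(u • x) = Q(x)` for every `u ∈ U(1)`, then at `x` it equals the
sum of its DIAGONAL monomials (`inl`-degree `=` `inr`-degree): `Q(u x) = Σ_d u^d · [Σ_{a−b=d} c_m x^m]` and the characters `u^d` are independent.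
[cite: JacquetLanglands1970, §6] -/
theorem eval_eq_sum_diagonal_of_circle_invariant (Q : MvPolynomial (Fin 2 ⊕ Fin 2) ℂ) (x : Fin 2 → ℂ)
    (hQ : ∀ u : Circle, eval (Sum.elim ((u : ℂ) • x) (fun i => conj (((u : ℂ) • x) i))) Q = eval (Sum.elim x (fun i => conj (x i))) Q) :
    eval (Sum.elim x (fun i => conj (x i))) Q =
      ∑ m ∈ Q.support with m (Sum.inl 0) + m (Sum.inl 1) = m (Sum.inr 0) + m (Sum.inr 1),
        eval (Sum.elim x (fun i => conj (x i))) (monomial m (Q.coeff m)) := by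
  classical
  -- notation: bidegree difference `δ m`, values `e m`
  set δ : ((Fin 2 ⊕ Fin 2) →₀ ℕ) → ℤ := fun m => ((m (Sum.inl 0) + m (Sum.inl 1) : ℕ) : ℤ) - ((m (Sum.inr 0) + m (Sum.inr 1) : ℕ) : ℤ) with hδ
  set e : ((Fin 2 ⊕ Fin 2) →₀ ℕ) → ℂ := fun m => eval (Sum.elim x (fun i => conj (x i))) (monomial m (Q.coeff m)) with he
  set D : Finset ℤ := insert 0 (Q.support.image δ) with hD
  -- the coefficient of `u^d`
  set g : ℤ → ℂ := fun d => (∑ m ∈ Q.support with δ m = d, e m) - if d = 0 then eval (Sum.elim x (fun i => conj (x i))) Q else 0 with hg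
  -- the value of `Q` at `u • x`, expanded along the characters
  have hexp : ∀ u : Circle, eval (Sum.elim ((u : ℂ) • x) (fun i => conj (((u : ℂ) • x) i))) Q = ∑ d ∈ D, (u : ℂ) ^ d * ∑ m ∈ Q.support with δ m = d, e m := by
    intro u
    have hu0 : (u : ℂ) ≠ 0 := Circle.coe_ne_zero u
    conv_lhs => rw [Q.as_sum]
    rw [map_sum]
    have hterm : ∀ m ∈ Q.support, eval (Sum.elim ((u : ℂ) • x) (fun i => conj (((u : ℂ) • x) i))) (monomial m (Q.coeff m)) = (u : ℂ) ^ δ m * e m := by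
      intro m _
      rw [eval_monomial_smul, he, hδ]
      simp only []
      rw [← Circle.coe_inv_eq_conj, zpow_sub₀ hu0, zpow_natCast, zpow_natCast, div_eq_mul_inv, ← inv_pow, Circle.coe_inv]
    rw [Finset.sum_congr rfl hterm]
    symm
    calc ∑ d ∈ D, (u : ℂ) ^ d * ∑ m ∈ Q.support with δ m = d, e m
        = ∑ d ∈ D, ∑ m ∈ Q.support with δ m = d, (u : ℂ) ^ δ m * e m := by
          refine Finset.sum_congr rfl fun d _ => ?_
          rw [Finset.mul_sum]
          refine Finset.sum_congr rfl fun m hm => ?_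
          rw [(Finset.mem_filter.1 hm).2]
      _ = ∑ m ∈ Q.support, (u : ℂ) ^ δ m * e m :=
          Finset.sum_fiberwise_of_maps_to (fun m hm => Finset.mem_insert_of_mem (Finset.mem_image_of_mem δ hm)) _
  -- the linear relation among the characters `u ↦ u^d`, `d ∈ D`
  have h0D : (0 : ℤ) ∈ D := Finset.mem_insert_self _ _
  have hrel : ∑ d ∈ D, g d • (fun u : Circle => ((u : ℂ) ^ d)) = 0 := by
    funext u
    simp only [Finset.sum_apply, Pi.smul_apply, smul_eq_mul, Pi.zero_apply, hg, sub_mul, Finset.sum_sub_distrib, ite_mul, zero_mul]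
    rw [Finset.sum_ite_eq' D (0 : ℤ), if_pos h0D, zpow_zero, mul_one,
      show ∑ d ∈ D, (∑ m ∈ Q.support with δ m = d, e m) * (u : ℂ) ^ d = ∑ d ∈ D, (u : ℂ) ^ d * ∑ m ∈ Q.support with δ m = d, e m from
        Finset.sum_congr rfl fun d _ => mul_comm _ _, ← hexp u, hQ u, sub_self]
  have hg0 : g 0 = 0 := linearIndependent_iff'.1 circle_chars_linearIndependent D g hrel 0 h0D
  simp only [hg, if_true, sub_eq_zero] at hg0
  rw [← hg0]
  refine Finset.sum_congr ?_ fun m _ => rfl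
  refine Finset.filter_congr fun m _ => ?_
  simp only [hδ, sub_eq_zero, Nat.cast_inj]

end CircleInvariance

/-! ## §3 The Γ-factor at a complex place (Tate's coordinates) -/

section Tate

/-- **`∫_ℂ z^a z̄^a e^{−2π|z|²} (|z|²)^{w−1} · 2 dz = (2π)^{1−w−a} Γ(w+a)`** for `re(w + a) > 0` — ★ `TateArchimedean.zeta_complex 0` at `s := w + a`
(`z^a z̄^a = (|z|²)^a`).  This is the arch Tate∕Godement coefficient of the diagonal bidegree `(a,a)`. [cite: Tate1950, §2.5 (k complex)] -/
theorem integral_pow_mul_conj_pow_gaussian_cpow (a : ℕ) {w : ℂ} (hw : 0 < (w + a).re) :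
    ∫ z : ℂ, z ^ a * conj z ^ a * cexp (-2 * π * (‖z‖ : ℂ) ^ 2) * (((‖z‖ ^ 2 : ℝ)) : ℂ) ^ (w - 1) * 2 =
      (2 * π : ℂ) ^ (1 - w - a) * Complex.Gamma (w + a) := by
  have h := Literature.NumberTheory.Automorphic.TateArchimedean.zeta_complex 0 (s := w + a) (by simpa using hw)
  simp only [pow_zero, one_mul, Nat.cast_zero, zero_div, add_zero, sub_zero] at h
  rw [show (1 : ℂ) - w - a = 1 - (w + a) by ring, ← h]
  refine integral_congr_ae ?_
  have h0 : ∀ᵐ z : ℂ ∂volume, z ≠ 0 := by simp [ae_iff]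
  filter_upwards [h0] with z hz
  have hb : (((‖z‖ ^ 2 : ℝ)) : ℂ) ≠ 0 := by exact_mod_cast (pow_pos (norm_pos_iff.2 hz) 2).ne'
  have hza : z ^ a * conj z ^ a = (((‖z‖ ^ 2 : ℝ)) : ℂ) ^ (a : ℂ) := by
    rw [cpow_natCast, ← mul_pow, Complex.mul_conj, Complex.normSq_eq_norm_sq]
  rw [hza, show w + a - 1 = (a : ℂ) + (w - 1) by ring, Complex.cpow_add _ _ hb]
  ring

/-- the Γ-factor `(2π)^{1−w−a} Γ(w+a)` does not vanish for `re(w + a) > 0`. [cite: Tate1950, §2.5] -/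
theorem gammaFactor_ne_zero (a : ℕ) {w : ℂ} (hw : 0 < (w + a).re) : (2 * π : ℂ) ^ (1 - w - a) * Complex.Gamma (w + a) ≠ 0 := by
  refine mul_ne_zero (fun h => ?_) (Complex.Gamma_ne_zero_of_re_pos hw)
  have h2 := (cpow_eq_zero_iff _ _).1 h
  exact (by exact_mod_cast Real.two_pi_pos.ne' : (2 * π : ℂ) ≠ 0) h2.1

/-- the INVERSE Γ-factor in closed form: `[(2π)^{1−w−a} Γ(w+a)]⁻¹ = (2π)^{w+a−1} · Γ(w+a)⁻¹` (all `w`). [cite: Tate1950, §2.5] -/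
theorem gammaFactor_inv_eq (a : ℕ) (w : ℂ) :
    ((2 * π : ℂ) ^ (1 - w - a) * Complex.Gamma (w + a))⁻¹ = (2 * π : ℂ) ^ (w + a - 1) * (Complex.Gamma (w + a))⁻¹ := by
  rw [mul_inv, ← Complex.cpow_neg]
  congr 2
  ring

/-- the inverse Γ-factor `w ↦ [(2π)^{1−w−a} Γ(w+a)]⁻¹` is ENTIRE (`1∕Γ` is entire). [cite: Tate1950, §2.5] -/
theorem differentiable_gammaFactor_inv (a : ℕ) :
    Differentiable ℂ fun w : ℂ => ((2 * π : ℂ) ^ (1 - w - a) * Complex.Gamma (w + a))⁻¹ := by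
  have h2 : (2 * π : ℂ) ≠ 0 := by exact_mod_cast Real.two_pi_pos.ne'
  have heq : (fun w : ℂ => ((2 * π : ℂ) ^ (1 - w - a) * Complex.Gamma (w + a))⁻¹) =
      fun w : ℂ => (2 * π : ℂ) ^ (w + a - 1) * (Complex.Gamma (w + a))⁻¹ := funext fun w => gammaFactor_inv_eq a w
  rw [heq]
  refine Differentiable.mul (fun w => ?_) (Complex.differentiable_one_div_Gamma.comp (differentiable_id.add_const _))
  exact ((differentiableAt_id.add_const _).sub_const _).const_cpow (Or.inl h2)

/-- **THE GODEMENT–TATE INTEGRAL OF A DIAGONAL MONOMIAL × GAUSSIAN AT A UNIT ROW**: for `m` of bidegree `(a, a)`, `Φ_m(y) = c y^m e^{−2π|y|²}` and `|x| = 1`,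
`∫_ℂ Φ_m(z • x) (|z|²)^{w−1} · 2 dz = (2π)^{1−w−a} Γ(w+a) · c x^m` (`Φ_m(z • x) = z^a z̄^a Φ-free part`, `|z • x|² = |z|²`).
[cite: Tate1950, §2.5 (k complex)] [cite: JacquetLanglands1970, §6] -/
theorem integral_godement_monomial (m : (Fin 2 ⊕ Fin 2) →₀ ℕ) (hm : m (Sum.inl 0) + m (Sum.inl 1) = m (Sum.inr 0) + m (Sum.inr 1)) (c : ℂ)
    {x : Fin 2 → ℂ} (hx : ‖x 0‖ ^ 2 + ‖x 1‖ ^ 2 = 1) {w : ℂ} (hw : 0 < (w + (m (Sum.inl 0) + m (Sum.inl 1) : ℕ)).re) :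
    ∫ z : ℂ, eval (Sum.elim (z • x) (fun i => conj ((z • x) i))) (monomial m c) *
        cexp (-2 * π * ((‖(z • x) 0‖ ^ 2 + ‖(z • x) 1‖ ^ 2 : ℝ) : ℂ)) * (((‖z‖ ^ 2 : ℝ)) : ℂ) ^ (w - 1) * 2 =
      ((2 * π : ℂ) ^ (1 - w - (m (Sum.inl 0) + m (Sum.inl 1) : ℕ)) * Complex.Gamma (w + (m (Sum.inl 0) + m (Sum.inl 1) : ℕ))) *
        eval (Sum.elim x (fun i => conj (x i))) (monomial m c) := by
  have hgauss : ∀ z : ℂ, ((‖(z • x) 0‖ ^ 2 + ‖(z • x) 1‖ ^ 2 : ℝ) : ℂ) = (‖z‖ : ℂ) ^ 2 := by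
    intro z
    simp only [Pi.smul_apply, smul_eq_mul, norm_mul, mul_pow, ← mul_add, hx, mul_one]
    push_cast
    ring
  have hpt : ∀ z : ℂ, eval (Sum.elim (z • x) (fun i => conj ((z • x) i))) (monomial m c) *
      cexp (-2 * π * ((‖(z • x) 0‖ ^ 2 + ‖(z • x) 1‖ ^ 2 : ℝ) : ℂ)) * (((‖z‖ ^ 2 : ℝ)) : ℂ) ^ (w - 1) * 2 =
      (z ^ (m (Sum.inl 0) + m (Sum.inl 1)) * conj z ^ (m (Sum.inl 0) + m (Sum.inl 1)) * cexp (-2 * π * (‖z‖ : ℂ) ^ 2) *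
        (((‖z‖ ^ 2 : ℝ)) : ℂ) ^ (w - 1) * 2) * eval (Sum.elim x (fun i => conj (x i))) (monomial m c) := by
    intro z
    rw [eval_monomial_smul, ← hm, hgauss z]
    ring
  simp_rw [hpt]
  rw [integral_mul_const, integral_pow_mul_conj_pow_gaussian_cpow _ hw]

end Tate

/-! ## §4 The `U(2)` plumbing: the `SU(2)` lift `κ(x) = !![conj x₁, −conj x₀; x₀, x₁]` -/

section Unitary

/-- the `(1,0)` entry of `A · Bᴴ` for `2 × 2` complex matrices. [folklore] -/
theorem mul_star_apply_one_zero (A B : Matrix (Fin 2) (Fin 2) ℂ) :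
    (A * star B) 1 0 = A 1 0 * conj (B 0 0) + A 1 1 * conj (B 0 1) := by
  rw [Matrix.star_eq_conjTranspose, Matrix.mul_apply, Fin.sum_univ_two, Matrix.conjTranspose_apply, Matrix.conjTranspose_apply]
  rfl

/-- the `(1,1)` entry of `A · Aᴴ`. [folklore] -/
theorem mul_star_apply_one_one (A : Matrix (Fin 2) (Fin 2) ℂ) :
    (A * star A) 1 1 = A 1 0 * conj (A 1 0) + A 1 1 * conj (A 1 1) := by
  rw [Matrix.star_eq_conjTranspose, Matrix.mul_apply, Fin.sum_univ_two, Matrix.conjTranspose_apply, Matrix.conjTranspose_apply]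
  rfl

/-- the bottom row of a unitary matrix is a unit vector: `k₁₀ k̄₁₀ + k₁₁ k̄₁₁ = 1`. [folklore] -/
theorem row_one_mul_conj_eq_one (k : Matrix.unitaryGroup (Fin 2) ℂ) :
    (k : Matrix (Fin 2) (Fin 2) ℂ) 1 0 * conj ((k : Matrix (Fin 2) (Fin 2) ℂ) 1 0) +
      (k : Matrix (Fin 2) (Fin 2) ℂ) 1 1 * conj ((k : Matrix (Fin 2) (Fin 2) ℂ) 1 1) = 1 := by
  have h := Matrix.mem_unitaryGroup_iff.1 k.2
  have h11 := congrFun (congrFun h 1) 1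
  rw [mul_star_apply_one_one, Matrix.one_apply_eq] at h11
  exact h11

/-- … in real form: `‖k₁₀‖² + ‖k₁₁‖² = 1`. [folklore] -/
theorem norm_row_one_sq_add (k : Matrix.unitaryGroup (Fin 2) ℂ) :
    ‖(k : Matrix (Fin 2) (Fin 2) ℂ) 1 0‖ ^ 2 + ‖(k : Matrix (Fin 2) (Fin 2) ℂ) 1 1‖ ^ 2 = 1 := by
  have h := row_one_mul_conj_eq_one k
  rw [Complex.mul_conj, Complex.mul_conj, Complex.normSq_eq_norm_sq, Complex.normSq_eq_norm_sq] at h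
  exact_mod_cast h

/-- **the `SU(2)` lift of a unit row is unitary**: `κ(x) κ(x)ᴴ = 1` for `x₀ x̄₀ + x₁ x̄₁ = 1`. [folklore] -/
theorem kappa_mem_unitaryGroup {x : Fin 2 → ℂ} (hx : x 0 * conj (x 0) + x 1 * conj (x 1) = 1) :
    !![conj (x 1), -conj (x 0); x 0, x 1] ∈ Matrix.unitaryGroup (Fin 2) ℂ := by
  rw [Matrix.mem_unitaryGroup_iff, ← Matrix.ext_iff]
  intro i j
  fin_cases i <;> fin_cases j <;>
    simp [Matrix.mul_apply, Fin.sum_univ_two, Matrix.star_eq_conjTranspose, Matrix.conjTranspose_apply] <;>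
    first | ring1 | linear_combination hx

/-- flatness in use: `F₀ k = F₀ k′` whenever `(k k′ᴴ)₁₀ = 0` (then `k k′⁻¹ ∈ B ∩ K`). [cite: JacquetLanglands1970, §5] -/
theorem apply_eq_of_mul_star_one_zero {F₀ : Matrix.unitaryGroup (Fin 2) ℂ → ℂ}
    (hB : ∀ p k : Matrix.unitaryGroup (Fin 2) ℂ, (p : Matrix (Fin 2) (Fin 2) ℂ) 1 0 = 0 → F₀ (p * k) = F₀ k)
    (k k' : Matrix.unitaryGroup (Fin 2) ℂ) (h : ((k : Matrix (Fin 2) (Fin 2) ℂ) * star (k' : Matrix (Fin 2) (Fin 2) ℂ)) 1 0 = 0) :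
    F₀ k = F₀ k' := by
  have hk : k = (k * k'⁻¹) * k' := (inv_mul_cancel_right k k').symm
  rw [hk]
  refine hB (k * k'⁻¹) k' ?_
  exact h

/-- **`F₀ k = F₀ κ(e₂ k)`** — a flat section on `U(2)` only sees the bottom row (`k κ(e₂k)ᴴ` is upper triangular: `(k κᴴ)₁₀ = k₁₀k₁₁ − k₁₁k₁₀ = 0`).
[cite: JacquetLanglands1970, §5] [cite: Bump1997, §2.8] -/
theorem apply_eq_apply_kappa {F₀ : Matrix.unitaryGroup (Fin 2) ℂ → ℂ}
    (hB : ∀ p k : Matrix.unitaryGroup (Fin 2) ℂ, (p : Matrix (Fin 2) (Fin 2) ℂ) 1 0 = 0 → F₀ (p * k) = F₀ k)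
    (k : Matrix.unitaryGroup (Fin 2) ℂ) :
    F₀ k = F₀ ⟨!![conj ((k : Matrix (Fin 2) (Fin 2) ℂ) 1 1), -conj ((k : Matrix (Fin 2) (Fin 2) ℂ) 1 0);
        (k : Matrix (Fin 2) (Fin 2) ℂ) 1 0, (k : Matrix (Fin 2) (Fin 2) ℂ) 1 1], kappa_mem_unitaryGroup (row_one_mul_conj_eq_one k)⟩ := by
  refine apply_eq_of_mul_star_one_zero hB k _ ?_
  rw [mul_star_apply_one_zero]
  simp only [Matrix.of_apply, Matrix.cons_val', Matrix.cons_val_zero, Matrix.cons_val_one, Matrix.empty_val', Matrix.cons_val_fin_one,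
    map_neg, Complex.conj_conj]
  ring

/-- the lift of `u • x` for `u ∈ U(1)` is again unitary. [folklore] -/
theorem smul_row_mul_conj_eq_one (u : Circle) {x : Fin 2 → ℂ} (hx : x 0 * conj (x 0) + x 1 * conj (x 1) = 1) :
    ((u : ℂ) • x) 0 * conj (((u : ℂ) • x) 0) + ((u : ℂ) • x) 1 * conj (((u : ℂ) • x) 1) = 1 := by
  have hu : (u : ℂ) * conj (u : ℂ) = 1 := by
    rw [Complex.mul_conj, Complex.normSq_eq_norm_sq, Circle.norm_coe]; simp
  simp only [Pi.smul_apply, smul_eq_mul, map_mul]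
  linear_combination (norm := ring_nf) (u : ℂ) * conj (u : ℂ) * hx + hu

/-- **circle invariance of `F₀ ∘ κ`**: `κ(u x) = diag(ū, u) κ(x)`, so `F₀ κ(u x) = F₀ κ(x)` (`(κ(ux) κ(x)ᴴ)₁₀ = u(x₀x₁ − x₁x₀) = 0`).
[cite: JacquetLanglands1970, §6] -/
theorem apply_kappa_smul {F₀ : Matrix.unitaryGroup (Fin 2) ℂ → ℂ}
    (hB : ∀ p k : Matrix.unitaryGroup (Fin 2) ℂ, (p : Matrix (Fin 2) (Fin 2) ℂ) 1 0 = 0 → F₀ (p * k) = F₀ k)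
    (u : Circle) {x : Fin 2 → ℂ} (hx : x 0 * conj (x 0) + x 1 * conj (x 1) = 1) :
    F₀ ⟨!![conj (((u : ℂ) • x) 1), -conj (((u : ℂ) • x) 0); ((u : ℂ) • x) 0, ((u : ℂ) • x) 1],
        kappa_mem_unitaryGroup (smul_row_mul_conj_eq_one u hx)⟩ =
      F₀ ⟨!![conj (x 1), -conj (x 0); x 0, x 1], kappa_mem_unitaryGroup hx⟩ := by
  refine apply_eq_of_mul_star_one_zero hB _ _ ?_
  rw [mul_star_apply_one_zero]
  simp only [Matrix.of_apply, Matrix.cons_val', Matrix.cons_val_zero, Matrix.cons_val_one, Matrix.empty_val', Matrix.cons_val_fin_one,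
    map_neg, Complex.conj_conj, Pi.smul_apply, smul_eq_mul]
  ring

/-- **`F₀ ∘ κ` is a polynomial in `(x, x̄)`**: the p05 face evaluated at `κ(x)` is `eval (x, x̄)` of the explicit substitution `Q = bind₁ θ P`
(`κ₀₀ = x̄₁`, `κ₀₁ = −x̄₀`, `κ₁₀ = x₀`, `κ₁₁ = x₁` and conjugates). [cite: JacquetLanglands1970, §6] -/
theorem eval_kappa (P : MvPolynomial ((Fin 2 × Fin 2) ⊕ (Fin 2 × Fin 2)) ℂ) (x : Fin 2 → ℂ) :
    eval (Sum.elim (fun ij : Fin 2 × Fin 2 => (!![conj (x 1), -conj (x 0); x 0, x 1] : Matrix (Fin 2) (Fin 2) ℂ) ij.1 ij.2)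
        (fun ij : Fin 2 × Fin 2 => conj ((!![conj (x 1), -conj (x 0); x 0, x 1] : Matrix (Fin 2) (Fin 2) ℂ) ij.1 ij.2))) P =
      eval (Sum.elim x (fun i => conj (x i)))
        (bind₁ (Sum.elim
          (fun ij : Fin 2 × Fin 2 => (!![X (Sum.inr 1), -X (Sum.inr 0); X (Sum.inl 0), X (Sum.inl 1)] :
            Matrix (Fin 2) (Fin 2) (MvPolynomial (Fin 2 ⊕ Fin 2) ℂ)) ij.1 ij.2)
          (fun ij : Fin 2 × Fin 2 => (!![X (Sum.inl 1), -X (Sum.inl 0); X (Sum.inr 0), X (Sum.inr 1)] :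
            Matrix (Fin 2) (Fin 2) (MvPolynomial (Fin 2 ⊕ Fin 2) ℂ)) ij.1 ij.2)) P) := by
  rw [K2LiuCompactGroupFiniteFunctions.eval_bind₁]
  refine congrFun (congrArg (fun f => (eval f : MvPolynomial ((Fin 2 × Fin 2) ⊕ (Fin 2 × Fin 2)) ℂ → ℂ)) ?_) P
  funext i
  rcases i with ⟨i, j⟩ | ⟨i, j⟩ <;> fin_cases i <;> fin_cases j <;>
    simp [Matrix.of_apply, Matrix.cons_val', Matrix.cons_val_zero, Matrix.cons_val_one, Matrix.empty_val', Matrix.cons_val_fin_one, eval_X]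

end Unitary

/-! ## §5 The (β0) face at a complex place -/

section Main

/-- **GODEMENT SECTIONS EXHAUST THE FLAT `U(2)`-FINITE SECTIONS AT A COMPLEX PLACE (RULING M-157b (β5)).**  Let `F₀ : U(2) → ℂ` be the restriction
to `K = U(2)` of a flat section of `Ind_B^{GL₂(ℂ)}(|·|^s, |·|^{−s})`: left-invariant under `B ∩ K` (`hB`) and — `K`-finiteness, ★ (K∞-str) face of K2Liu-p05 —
a POLYNOMIAL in the entries and their conjugates (`hF`).  Then there are FINITELY many diagonal monomials `m` (bidegree `(a(m), a(m))`) and coefficients `c m`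
such that for EVERY `w` with `0 < re w` (`w = 2s`) and every `k ∈ U(2)`:
`F₀ k = Σ_m [(2π)^{1−w−a(m)} Γ(w+a(m))]⁻¹ · ∫_ℂ Φ_m(z • e₂k) (|z|²)^{w−1} · 2 dz`,  `Φ_m(y) = c_m y^m e^{−2π(|y₀|²+|y₁|²)}`,
i.e. `F₀` is a finite combination, with ENTIRE coefficients (`differentiable_gammaFactor_inv`), of the Godement–Tate arch sections of the `K`-finite Schwartz data `Φ_m`
(polynomial × Gaussian).  [cite: JacquetLanglands1970, §6] [cite: Tate1950, §2.5] [cite: Bump1997, §3.7] [cite: CogdellAnalyticTheory2004, §2.3] -/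
theorem exists_godement_arch_of_flat_polynomial (F₀ : Matrix.unitaryGroup (Fin 2) ℂ → ℂ)
    (P : MvPolynomial ((Fin 2 × Fin 2) ⊕ (Fin 2 × Fin 2)) ℂ)
    (hF : ∀ k : Matrix.unitaryGroup (Fin 2) ℂ, F₀ k = MvPolynomial.eval
      (Sum.elim (fun ij : Fin 2 × Fin 2 => (k : Matrix (Fin 2) (Fin 2) ℂ) ij.1 ij.2)
        (fun ij : Fin 2 × Fin 2 => conj ((k : Matrix (Fin 2) (Fin 2) ℂ) ij.1 ij.2))) P)
    (hB : ∀ p k : Matrix.unitaryGroup (Fin 2) ℂ, (p : Matrix (Fin 2) (Fin 2) ℂ) 1 0 = 0 → F₀ (p * k) = F₀ k) :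
    ∃ (ι : Finset ((Fin 2 ⊕ Fin 2) →₀ ℕ)) (c : ((Fin 2 ⊕ Fin 2) →₀ ℕ) → ℂ),
      (∀ m ∈ ι, m (Sum.inl 0) + m (Sum.inl 1) = m (Sum.inr 0) + m (Sum.inr 1)) ∧
      ∀ w : ℂ, 0 < w.re → ∀ k : Matrix.unitaryGroup (Fin 2) ℂ,
        F₀ k = ∑ m ∈ ι, ((2 * π : ℂ) ^ (1 - w - (m (Sum.inl 0) + m (Sum.inl 1) : ℕ)) *
            Complex.Gamma (w + (m (Sum.inl 0) + m (Sum.inl 1) : ℕ)))⁻¹ *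
          ∫ z : ℂ, eval (Sum.elim (z • (k : Matrix (Fin 2) (Fin 2) ℂ) 1) (fun i => conj ((z • (k : Matrix (Fin 2) (Fin 2) ℂ) 1) i)))
              (monomial m (c m)) *
            cexp (-2 * π * ((‖(z • (k : Matrix (Fin 2) (Fin 2) ℂ) 1) 0‖ ^ 2 + ‖(z • (k : Matrix (Fin 2) (Fin 2) ℂ) 1) 1‖ ^ 2 : ℝ) : ℂ)) *
            (((‖z‖ ^ 2 : ℝ)) : ℂ) ^ (w - 1) * 2 := by
  classical
  -- the polynomial `Q = F₀ ∘ κ`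
  set Q : MvPolynomial (Fin 2 ⊕ Fin 2) ℂ := bind₁ (Sum.elim
      (fun ij : Fin 2 × Fin 2 => (!![X (Sum.inr 1), -X (Sum.inr 0); X (Sum.inl 0), X (Sum.inl 1)] :
        Matrix (Fin 2) (Fin 2) (MvPolynomial (Fin 2 ⊕ Fin 2) ℂ)) ij.1 ij.2)
      (fun ij : Fin 2 × Fin 2 => (!![X (Sum.inl 1), -X (Sum.inl 0); X (Sum.inr 0), X (Sum.inr 1)] :
        Matrix (Fin 2) (Fin 2) (MvPolynomial (Fin 2 ⊕ Fin 2) ℂ)) ij.1 ij.2)) P with hQ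
  have hFκ : ∀ {x : Fin 2 → ℂ} (hx : x 0 * conj (x 0) + x 1 * conj (x 1) = 1),
      F₀ ⟨!![conj (x 1), -conj (x 0); x 0, x 1], kappa_mem_unitaryGroup hx⟩ = eval (Sum.elim x (fun i => conj (x i))) Q := by
    intro x hx
    rw [hF, hQ, ← eval_kappa P x]
  refine ⟨Q.support.filter (fun m => m (Sum.inl 0) + m (Sum.inl 1) = m (Sum.inr 0) + m (Sum.inr 1)), fun m => Q.coeff m,
    fun m hm => (Finset.mem_filter.1 hm).2, fun w hw k => ?_⟩
  -- the bottom row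
  set x : Fin 2 → ℂ := (k : Matrix (Fin 2) (Fin 2) ℂ) 1 with hx
  have hxC : x 0 * conj (x 0) + x 1 * conj (x 1) = 1 := row_one_mul_conj_eq_one k
  have hxR : ‖x 0‖ ^ 2 + ‖x 1‖ ^ 2 = 1 := norm_row_one_sq_add k
  -- `F₀ k = Q(x)`, and `Q` is circle-invariant at `x`
  have h1 : F₀ k = eval (Sum.elim x (fun i => conj (x i))) Q := by rw [apply_eq_apply_kappa hB k]; exact hFκ hxC
  have hcirc : ∀ u : Circle, eval (Sum.elim ((u : ℂ) • x) (fun i => conj (((u : ℂ) • x) i))) Q = eval (Sum.elim x (fun i => conj (x i))) Q := by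
    intro u
    rw [← hFκ (smul_row_mul_conj_eq_one u hxC), ← hFκ hxC]
    exact apply_kappa_smul hB u hxC
  rw [h1, eval_eq_sum_diagonal_of_circle_invariant Q x hcirc]
  refine Finset.sum_congr rfl fun m hm => ?_
  have hmd : m (Sum.inl 0) + m (Sum.inl 1) = m (Sum.inr 0) + m (Sum.inr 1) := (Finset.mem_filter.1 hm).2
  have hw' : 0 < (w + (m (Sum.inl 0) + m (Sum.inl 1) : ℕ)).re := by
    simp only [Complex.add_re, Complex.natCast_re]; positivity
  rw [integral_godement_monomial m hmd (Q.coeff m) hxR hw', ← mul_assoc, inv_mul_cancel₀ (gammaFactor_ne_zero _ hw'), one_mul]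

end Main

end Summit.HodgeConjecture.HodgeConjecture.Cruxes.HLiu418.K2LiuGL2GodementSectionOfFlatArch

end
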